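import Summits.BirchSwinnertonDyer.BirchSwinnertonDyer.Theorems.WildThreeRankOneBSDpOfExactIndexManin
import Literature.NumberTheory.EllipticCurves.KolyvaginShaIndexBound
import Literature.NumberTheory.EllipticCurves.BSDHeegnerPointsGrossZagierProofs
import Literature.NumberTheory.EllipticCurves.KrizLi2019.SexticTwistBSDThreeDescent
import Literature.NumberTheory.EllipticCurves.GlobalMinimalModelProofs
import Summits.BirchSwinnertonDyer.Rank1Residual.X11b.KolyvaginBottomPoint
import Summits.BirchSwinnertonDyer.Rank1Residual.X11b.Three.KolyvaginLine
import Literature.NumberTheory.EllipticCurves.KolyvaginShaStructureDivisibility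
import Literature.NumberTheory.EllipticCurves.HeegnerPointsOfConductorOneData
import Literature.NumberTheory.EllipticCurves.HeegnerPointsOfConductorOneRationalityProofs
import Literature.NumberTheory.EllipticCurves.HeegnerPointsOfConductorOneGaloisConjProofs
import Literature.NumberTheory.EllipticCurves.HeegnerPointsKolyvaginPrimaryGeneratorProofs
import Literature.NumberTheory.EllipticCurves.BSDSelmerCMPConverseHeegnerFieldProofs
import HarnessLib

/-!
# The KOLYVAGIN-SIDE receptacle of the wild rank-one row at `3` in Manin-robust currency: GLOBAL
# DIVISIBILITY of the derived Heegner points to depth `v₃ ∏_ℓ c_ℓ(E) + v₃(c)` ⟹ co-STEP L at slack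
# `v₃(c)`; on the JET-PRODUCT sub-leaf (`v₃[E(K):ℤy_K] = v₃ ∏_ℓ c_ℓ(E) + v₃(c)`) the IMC side is idle and
# `BSD₃(E^{d_K}) ⟹ BSD₃(E)` (route-free; cell `bsd-wall`, D-0131 (3) M-UTD, seat `bsd-wall-utd-p3` gen 1)

Companion of gen 0's `WildThreeRankOneBSDpOfHeegnerIndexCoprime.lean` (p534641/p536116: the COPRIME
sub-leaf, where Kolyvagin's printed bound alone makes the index exact) and of the UTD kernel
`UniversalToricDescentToricKernelAtThree.lean` (p533077, item 20390 CLOSED: the EXACT index at slack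
`v₃(c)` — `SchneiderFree.IndexLowerBoundLeAt ∧ SchneiderFree.Upper.IndexUpperBoundLeAt` — from the route's
IMC cruxes). ROUTE-FREE (imports no `Theses.*`). Here the UPPER socket (co-STEP L,
`ord₃ #Ш(E/K) + 2·ord₃ ∏_ℓ c_ℓ(E) + 2·v₃(c) ≤ 2·ord₃ [E(K):ℤP]`) is produced the way Jetchev 2008 produces
his Cor. 1.5 at `p ∤ N` — Kolyvagin's STRUCTURE theorem in McCallum's upper form + global divisibility of
the derived Heegner points — with the research content isolated as ONE displayed hypothesis:

* §1 (generic `p`, arithmetic only) `indexBounds_of_upper_of_index_le` — the upper socket at slack `s`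
  together with `ord_p [E(K):ℤP] ≤ ord_p ∏_ℓ c_ℓ(E) + s` forces `ord_p #Ш(E/K) = 0` and BOTH sockets
  (the LOWER socket — STEP L, the IMC side — is then idle); `upper_zero_of_kolyvagin_of_not_dvd_tamagawa`
  — Kolyvagin's PRINTED bound (`Kolyvagin1990_padicValNat_card_sha_le`, McCallum §1: `p` odd, `ρ̄_{E,p}`
  onto, NO `p ∤ N` clause) gives the upper socket at slack `0` whenever `p ∤ ∏_ℓ c_ℓ(E)`, for ANY index.
* §2 (generic odd `p`) **`upper_of_globalDivisibility`** — THE RECEPTACLE: for `W/ℚ` globally minimal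
  with `ρ_{E,p^n}` onto for all `n` (the `p`-adic TOWER: McCallum's (H1); NOT implied by `ρ̄_{E,p}` onto at
  an additive `3`, Elkies 2006), `K` imaginary quadratic Heegner for `N_E` with `d_K ∉ {−3, −4}`, a
  Heegner point `P = y_K` of the datum `(Dt, H, ι)` of infinite order: IF every derived Heegner point `P_n`
  on the frame `(Dt, H.β, ι)` (square-free `n`, Kolyvagin primes of index `≥ s′`) is `p^{s′}`-divisible in
  `E(K[n])` for every `s′ ≤ ord_p ∏_ℓ c_ℓ(E) + s` (the displayed hypothesis `hglob` — Jetchev's Conj. 1.3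
  «`m_∞ ≥ ord_p(c·∏ c_q)`» half READ at the frame; NOT in print at `p ∣ N`) and McCallum 1991 Cor. 5.6
  upper form holds (named fact `McCallum1991_padicValNat_card_sha_primary_add_le_of_globalDivisibility`,
  hypothesis), THEN `Upper.IndexUpperBoundLeAt W p K P s`. Kernel steps: non-CM (Zywina); the conductor-`1`
  Kolyvagin datum exists (Darmon 2004 Thm. 3.6, tree theorem `phi_heegnerTau_mem_singularModuliField_holds`)
  with bottom point `P` (Shimura reciprocity, tree theorem `heegnerPointOfConductor_one_galoisConj_holds`);
  `p^{M₀} ∥ P` (Mordell–Weil); `ord_p [E(K):ℤP] = M₀` (McCallum Lemma 5.1: rank one by Kolyvagin, `E(K)[p] = 0`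
  since `ρ̄` onto ⟹ irreducible); `ord_p #Ш = ord_p #Ш[p^∞]` (`Ш(E/K)` finite by Kolyvagin).
* §3 (`p = 3`, the wild row) **`bsdp_three_of_indexEqTamagawaManin_of_globalDivisibility_of_wAllExclAddWildRankZero`**
  — THE JET-PRODUCT SUB-LEAF CLASS THEOREM: `ClassO6 W 3`, `r_an = 1`, `3`-adic tower onto, ONE Heegner
  datum with odd `d_K` and `L(E^{d_K},1) ≠ 0` whose index is JET-exact
  (`ord₃ [E(K):ℤP] = ord₃ ∏_ℓ c_ℓ(E) + v₃(c)`, the census shape `i3 = t3` at `c = 1`): global divisibility to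
  that depth on the frame (displayed) + McCallum (named) + the rank-zero wild leaf `WAllExclAddWildRankZero`
  (hypothesis) ⟹ `BSDp W 3` (kmc g17's `bsdp_three_of_exactIndexManin_of_wAllExclAddWildRankZero`,
  p528981). NO anticyclotomic main conjecture, NO `p`-adic `L`-function, NO control theorem, NO twin.
* The TAM-FREE sub-leaf (`3 ∤ ∏_ℓ c_ℓ(E)·c`: the upper socket is §1's printed bound, so STEP L at slack `0` +
  the rank-zero wild leaf ⟹ `BSDp W 3`) and the UNION (both sockets as inputs) are the sequel file
  `WildThreeRankOneBSDpOfGlobalDivisibilityStepL.lean`.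

PARTITION currency (census `bsd-wall-census/blockA/BLOCK-A-index.md` T17, READ; onto-W `r_an = 1`
residue = 3 894 classes, R758: 3 893): JET-PRODUCT (`i3 = t3 ≥ 2`, `Ш_an(E)` `3`-free) **3 413** = §3's
habitat (one divisibility statement + McCallum + leaf #6; the IMC side idle) ∩ {`3`-adic tower onto —
NOT a census column yet}; TAM3FREE INDEX-EXCESS (`t3 = 0 < i3`) **289** = the sequel's habitat (upper
socket printed; STEP L + leaf #6); the rest (INDEX-EXCESS with `t3 ≥ 1`: 183, SHA3-AN: 9) needs both sockets.
HONEST FRAMING: every theorem is CONDITIONAL on its displayed research input(s), on the named facts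
(hypotheses) and on the leaf `WAllExclAddWildRankZero` (hypothesis); per datum; closes no item and no
class; «beyond-print theorem»: NO. Whether a computed index identity at one admissible `K` is an admissible
per-class input is the referee desks' call. BSD is not proved for any curve by this file. No definition,
no named fact, no `sorry`. References: [McCallumLMS1991] §1 Theorem (p. 296), §5 Lemma 5.1 (p. 303),
Cor. 5.6 (p. 310); [Jetchev2008] Conj. 1.3, Thm. 1.4, Cor. 1.5 and (1) (Compos. Math. 144 (2008) p. 812);
[GrossLMS1991] Thm. 1.3, Prop. 2.1, §4 (4.1); [Darmon2004] Thm. 3.6–3.7; [JetchevSkinnerWan2017] §7.4.1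
(arXiv:1512.06894 p. 30); [GrossZagier1986] Thm. I.(6.3), V.§2; [Elkies2006] Introduction.
-/

noncomputable section

open scoped Classical

set_option linter.dupNamespace false
set_option autoImplicit false

namespace Summit.BirchSwinnertonDyer.BirchSwinnertonDyer.Theorems.SchneiderFree.Exact

open WeierstrassCurve NumberField IsDedekindDomain Field
  Literature.NumberTheory.EllipticCurves
  Literature.NumberTheory.EllipticCurves.ModularForms
  Literature.NumberTheory.EllipticCurves.Rank1Residual
  Literature.NumberTheory.EllipticCurves.KrizLi2019
  Summit.BirchSwinnertonDyer.Rank1Residual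
  Summit.BirchSwinnertonDyer.Rank1Residual.Additive
  Summit.BirchSwinnertonDyer.Rank1Residual.X11b
  Summit.BirchSwinnertonDyer.Rank1Residual.X11b.Three

/-! ### §1 Arithmetic of the sockets (generic `p`) -/

/-- **JET-PRODUCT reading: the upper socket + `ord_p[E(K):ℤP] ≤ ord_p ∏_ℓ c_ℓ(E) + s` give BOTH sockets
at slack `s` and `ord_p #Ш(E/K) = 0`.** From `ord_p #Ш(E/K) + 2·ord_p ∏c + 2s ≤ 2·ord_p I ≤ 2·ord_p ∏c + 2s`:
`ord_p #Ш(E/K) = 0` and the lower socket `2·ord_p I ≤ ord_p #Ш + 2·ord_p ∏c + 2s` holds (with equality). So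
on a datum whose index is JET-exact the LOWER socket (STEP L, the IMC side) is idle. Pure arithmetic.
[cite: Jetchev2008, Cor. 1.5 and (1) (p. 812)] [cite: JetchevSkinnerWan2017, §7.4.1 (arXiv:1512.06894 p. 30)] -/
theorem indexBounds_of_upper_of_index_le
    {W : WeierstrassCurve ℚ} {p : ℕ} {K : Type} [Field K] [NumberField K]
    {P : (W.baseChange K).toAffine.Point} {s : ℕ} (hup : Upper.IndexUpperBoundLeAt W p K P s)
    (hI : padicValNat p (AddSubgroup.zmultiples P).index ≤ padicValNat p W.tamagawaProduct + s) :
    padicValNat p (W.baseChange K).shaOrder = 0 ∧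
      IndexLowerBoundLeAt W p K P s ∧ Upper.IndexUpperBoundLeAt W p K P s := by
  unfold Upper.IndexUpperBoundLeAt at hup ⊢
  unfold IndexLowerBoundLeAt
  omega

/-- **TAM-FREE reading: Kolyvagin's PRINTED bound gives the upper socket at slack `0` for ANY index when
`p ∤ ∏_ℓ c_ℓ(E)`.** For an odd prime `p` with `ρ̄_{E,p}` onto, a Heegner field `K` for `N`, a Heegner point
`P` of the datum `(Dt, H, ι)` of infinite order: `ord_p #Ш(E/K) ≤ 2·ord_p [E(K):ℤP]` (named fact
`Kolyvagin1990_padicValNat_card_sha_le`, McCallum 1991 §1 — `p` odd and `Gal(ℚ(E_p)/ℚ) = GL₂` only, NO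
`p ∤ N` clause; hypothesis) is `Upper.IndexUpperBoundLeAt W p K P 0` once `ord_p ∏_ℓ c_ℓ(E) = 0`.
[cite: McCallumLMS1991, §1 Theorem (Kolyvagin), p. 296] [cite: GrossLMS1991, §1 Thm. 1.3 (2)] -/
theorem upper_zero_of_kolyvagin_of_not_dvd_tamagawa
    {N : ℕ} [NeZero N] {W : WeierstrassCurve ℚ} [W.IsElliptic] {K : Type} [Field K] [NumberField K]
    (hB : Kolyvagin1990_padicValNat_card_sha_le N W K) {p : ℕ} [Fact p.Prime] (hp2 : p ≠ 2)
    (hρ : W.HasSurjectiveModNGaloisRep p) (hK : IsImaginaryQuadratic K)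
    (hHH : SatisfiesHeegnerHypothesis N K) (Dt : ModularParametrizationData W N)
    (H : HeegnerDatum N (NumberField.discr K)) (ι : K →+* ℂ) {P : (W.baseChange K).toAffine.Point}
    (hP : WeierstrassCurve.Affine.Point.map ι.toRatAlgHom P = heegnerPointComplex Dt H)
    (hnt : ¬ IsOfFinAddOrder P) (htam : ¬ p ∣ W.tamagawaProduct) :
    Upper.IndexUpperBoundLeAt W p K P 0 := by
  have hp : p.Prime := Fact.out
  have hsha : padicValNat p (Nat.card (W.baseChange K).sha) ≤
      2 * padicValNat p (AddSubgroup.zmultiples P).index :=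
    hB hK hHH ⟨Dt, H, ι, hP⟩ hnt hp hp2 hρ
  have htam0 : padicValNat p W.tamagawaProduct = 0 := padicValNat.eq_zero_of_not_dvd htam
  unfold Upper.IndexUpperBoundLeAt
  show padicValNat p (Nat.card (W.baseChange K).sha) + 2 * padicValNat p W.tamagawaProduct + 2 * 0 ≤ _
  omega

/-! ### §2 THE RECEPTACLE: global divisibility of the derived Heegner points ⟹ the upper socket -/

/-- **Global `p^{s′}`-divisibility of the derived Heegner points to depth `ord_p ∏_ℓ c_ℓ(E) + s` ⟹ co-STEP L
at slack `s`** (generic odd `p`; the Kolyvagin-side receptacle of the Manin-robust sockets). For `W/ℚ`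
globally minimal with `ρ_{E,p^n}` onto for every `n` (the `p`-adic tower — McCallum's (H1); at an additive
`3` it is NOT implied by `ρ̄_{E,3}` onto), `K` imaginary quadratic satisfying the Heegner hypothesis for
`N_E = W.conductorNorm ℤ` with `d_K ∉ {−3, −4}`, a parametrisation datum `Dt` of level `N_E`, a Heegner
datum `H`, `ι : K → ℂ`, and `P ∈ E(K)` with `ι(P) = heegnerPointComplex Dt H` of infinite order: IF
(`hglob`, DISPLAYED research input — Jetchev 2008 Conj. 1.3 «`m_∞ = ord_p(∏ c_q)`», divisibility half, READ
at this frame with the Manin slack; NOT in print at `p ∣ N`) for every `s′ ≤ ord_p ∏_ℓ c_ℓ(E) + s`, every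
square-free `n` all of whose prime factors are Kolyvagin primes of index `≥ s′`, and every
Kolyvagin–Heegner datum `d` of conductor `n` on the frame `(Dt, H.β, ι)`, the derived point `P_n` is
`p^{s′}`-divisible in `E(K[n])` (`Koly.PDiv d p s′`), and McCallum 1991 Cor. 5.6 upper form holds (`hMcU`,
named fact, hypothesis), THEN `Upper.IndexUpperBoundLeAt W p K P s`, i.e.
`ord_p #Ш(E/K) + 2·ord_p ∏_ℓ c_ℓ(E) + 2s ≤ 2·ord_p [E(K):ℤP]` (kernel steps: module docstring, §2; rank one
and `Ш(E/K)` finite by `kolyvagin`, hypothesis).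
[cite: McCallumLMS1991, §5 Cor. 5.6 (p. 310) and Lemma 5.1 (p. 303)]
[cite: Jetchev2008, Conj. 1.3, Thm. 1.4, Cor. 1.5 and (1) (p. 812)] [cite: Darmon2004, Thm. 3.6–3.7]
[cite: GrossLMS1991, §4 (4.1) and Thm. 1.3] -/
theorem upper_of_globalDivisibility
    (hKo : ∀ (N : ℕ) [NeZero N] (W : WeierstrassCurve ℚ) (K : Type) [Field K] [NumberField K],
      kolyvagin N W K)
    (hMcU : McCallum1991_padicValNat_card_sha_primary_add_le_of_globalDivisibility)
    (W : WeierstrassCurve ℚ) [W.IsElliptic] [W.IsGloballyMinimal] [NeZero (W.conductorNorm ℤ)]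
    (p : ℕ) [Fact p.Prime] (hp2 : p ≠ 2) (hρ : ∀ n : ℕ, W.HasSurjectiveModNGaloisRep (p ^ n : ℕ))
    (K : Type) [Field K] [NumberField K] (hK : IsImaginaryQuadratic K)
    (h3 : NumberField.discr K ≠ -3) (h4 : NumberField.discr K ≠ -4)
    (hHH : SatisfiesHeegnerHypothesis (W.conductorNorm ℤ) K)
    (Dt : ModularParametrizationData W (W.conductorNorm ℤ))
    (H : HeegnerDatum (W.conductorNorm ℤ) (NumberField.discr K)) (ι : K →+* ℂ)
    (P : (W.baseChange K).toAffine.Point)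
    (hP : WeierstrassCurve.Affine.Point.map ι.toRatAlgHom P = heegnerPointComplex Dt H)
    (hnt : ¬ IsOfFinAddOrder P) {s : ℕ}
    (hglob : ∀ (s' : ℕ), s' ≤ padicValNat p W.tamagawaProduct + s →
      ∀ (n : ℕ) (d : KolyvaginHeegnerData Dt H.β ι n), Squarefree n →
        (∀ ℓ ∈ n.primeFactors, Zhang2014.IsKolyvaginPrime (W.conductorNorm ℤ) W K p ℓ ∧
          s' ≤ Zhang2014.kolyvaginIndex W p ℓ) → Koly.PDiv d p s') :
    Upper.IndexUpperBoundLeAt W p K P s := by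
  have hp : p.Prime := Fact.out
  -- mod-`p` image onto, hence irreducible and non-CM
  have hsurj : W.HasSurjectiveModNGaloisRep p := by simpa using hρ 1
  have hCM : ¬ W.HasCM := fun hCM ↦ W.not_hasSurjectiveModNGaloisRep_of_hasCM hCM hp hp2 hsurj
  haveI : NeZero ((p : ℕ) : ℚ) := ⟨by exact_mod_cast hp.ne_zero⟩
  have hirr : W.HasIrreducibleModPGaloisRep p :=
    hasIrreducibleModPGaloisRep_of_hasSurjectiveModNGaloisRep W p hsurj
  -- rank one and `Ш(E/K)` finite (Kolyvagin)
  obtain ⟨hrank, hfin⟩ := hKo (W.conductorNorm ℤ) W K hK hHH ⟨Dt, H, ι, hP⟩ hnt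
  haveI : Finite (W.baseChange K).sha := hfin
  -- no `p`-torsion in `E(K)`
  have hbot := torsionBy_eq_bot_of_isImaginaryQuadratic_of_hasIrreducibleModPGaloisRep W K hK hp hirr
  have hiv : ∀ x : (W.baseChange K).toAffine.Point, p • x = 0 → x = 0 := fun x hx ↦ by
    have hmem : x ∈ AddSubgroup.torsionBy (W.baseChange K).toAffine.Point ((p : ℕ) : ℤ) := by
      rw [mem_torsionBy_iff, natCast_zsmul]
      exact hx
    rw [hbot] at hmem
    exact hmem
  -- the conductor-`1` Kolyvagin–Heegner datum on the frame `(Dt, H.β, ι)` (Darmon 2004, Thm. 3.6)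
  obtain ⟨d₁⟩ := exists_kolyvaginHeegnerData_one
    (phi_heegnerTau_mem_singularModuliField_holds (W.conductorNorm ℤ) W K) hK Dt H.β ι H.dvd_sq_sub
  -- its bottom point is `P` in `E(K̄)` (Shimura reciprocity at conductor `1`)
  have hPd : d₁.toGeomPoints d₁.derivedPoint = toGeomPoints (W.baseChange K) P :=
    KolyvaginBottom.toGeomPoints_derivedPoint_one_eq
      (heegnerPointOfConductor_one_galoisConj_holds (W.conductorNorm ℤ) W K) hK hHH hP d₁ rfl
  -- `p^{M₀} ∥ P` (Mordell–Weil)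
  haveI : Module.Finite ℤ (W.baseChange K).toAffine.Point := (W.baseChange K).module_finite_point_holds
  obtain ⟨M₀, x₀, hx₀, hmax⟩ := exists_pow_smul_eq_and_forall_ne hnt (p := p) hp.two_le
  have hdiv : ∃ Q : (W.baseChange K).toAffine.Point, ((p ^ M₀ : ℕ) : ℤ) • Q = P :=
    ⟨x₀, by rw [natCast_zsmul]; exact hx₀⟩
  have hndiv : ¬ ∃ Q : (W.baseChange K).toAffine.Point, ((p ^ (M₀ + 1) : ℕ) : ℤ) • Q = P := by
    rintro ⟨Q, hQ⟩
    exact hmax Q (by rw [← natCast_zsmul]; exact hQ)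
  -- McCallum's Cor. 5.6, upper form, with `t := ord_p ∏c + s`
  have hle : padicValNat p (Nat.card (AddCommGroup.primaryComponent (W.baseChange K).sha p)) +
      2 * (padicValNat p W.tamagawaProduct + s) ≤ 2 * M₀ :=
    hMcU W hCM K hK h3 h4 hHH p hp2 hρ Dt H.β ι d₁ P hPd hnt M₀ hdiv hndiv
      (padicValNat p W.tamagawaProduct + s) (fun s' hs' n d hn hℓ ↦ hglob s' hs' n d hn hℓ)
  -- `ord_p #Ш = ord_p #Ш[p^∞]` and `ord_p [E(K):ℤP] = M₀`
  have hsha : padicValNat p (W.baseChange K).shaOrder =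
      padicValNat p (Nat.card (AddCommGroup.primaryComponent (W.baseChange K).sha p)) :=
    Koly.padicValNat_shaOrder_eq (W.baseChange K) p
  haveI : Finite (AddCommGroup.torsion (W.baseChange K).toAffine.Point) :=
    WeierstrassCurve.finite_torsion_point (W := W.baseChange K)
  obtain ⟨c, Q, hcQ, hcker⟩ := RankOne.exists_coord_of_mordellWeilRank_eq_one (W.baseChange K) hrank
  have hidx : padicValNat p (AddSubgroup.zmultiples P).index = M₀ :=
    Koly.padicValNat_index_zmultiples_eq_of_divisibility c Q hcQ hcker hiv P hdiv hndiv
  unfold Upper.IndexUpperBoundLeAt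
  rw [hidx, hsha]
  omega

/-! ### §3 THE JET-PRODUCT SUB-LEAF of the wild rank-one row at `3` -/

/-- **JET-PRODUCT sub-leaf of W-ALL row 2·3@3: global divisibility + the rank-zero wild leaf ⟹ `BSD₃(E)`, the
IMC side idle.** For `E` (globally minimal `W`) on `ClassO6 W 3` (wild additive `3`) with `r_an(E) = 1` and
`ρ_{E,3^n}` onto for every `n`, and ONE Heegner datum `(K, Dt, H, ι, P)` at level `N_E` — `K` imaginary
quadratic with ODD `d_K` satisfying the Heegner hypothesis, `L(E^{d_K},1) ≠ 0`, `P = y_K` — whose index is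
JET-exact, `ord₃ [E(K):ℤP] = ord₃ ∏_ℓ c_ℓ(E) + v₃(c)` (`hI`; the census shape `i3 = t3` at `c = 1`): global
`3^{s′}`-divisibility of the derived Heegner points on the frame `(Dt, H.β, ι)` for all
`s′ ≤ ord₃ ∏_ℓ c_ℓ(E) + v₃(c)` (`hglob`, DISPLAYED research input), McCallum's Cor. 5.6 upper form (`hMcU`,
named), Gross–Zagier / Kolyvagin / GZK / modularity / GZ86 I.(7.3) (named, hypotheses) and the leaf
`WAllExclAddWildRankZero` (hypothesis; it pays `BSD₃` of a minimal model of `E^{d_K}`, a non-CM wild row of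
analytic rank `0`) give `BSDp W 3`: §2 gives the upper socket at slack `v₃(c)`, §1 the lower one, and kmc
g17's `bsdp_three_of_exactIndexManin_of_wAllExclAddWildRankZero` descends (`d_K ∉ {−3, −4}`: `3 ∣ N_E` splits,
`d_K` odd; `P` non-torsion by Gross–Zagier). NO main conjecture, NO `p`-adic `L`-function, NO control
theorem, NO twin. CONDITIONAL; per datum; closes nothing by itself.
[cite: McCallumLMS1991, §5 Cor. 5.6 (p. 310) and Lemma 5.1 (p. 303)] [cite: Jetchev2008, Conj. 1.3 and Cor. 1.5 (p. 812)]
[cite: JetchevSkinnerWan2017, §7.4.1 (arXiv:1512.06894 p. 30)] [cite: GrossZagier1986, Thm. I.(6.3) and V.§2] -/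
theorem bsdp_three_of_indexEqTamagawaManin_of_globalDivisibility_of_wAllExclAddWildRankZero
    (hGZ : ∀ (N : ℕ) [NeZero N] (W : WeierstrassCurve ℚ) (K : Type) [Field K] [NumberField K],
      gross_zagier N W K)
    (hKo : ∀ (N : ℕ) [NeZero N] (W : WeierstrassCurve ℚ) (K : Type) [Field K] [NumberField K],
      kolyvagin N W K)
    (hGZK : rank_eq_analyticRank_of_analyticRank_le_one) (hmod : hasEntireLFunction_rat)
    (hGZ73 : GrossZagier1986_thm_I_7_3)
    (hMcU : McCallum1991_padicValNat_card_sha_primary_add_le_of_globalDivisibility)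
    (hRZ : Summit.BirchSwinnertonDyer.WAllExclAddWildRankZero)
    (W : WeierstrassCurve ℚ) [W.IsElliptic] [W.IsGloballyMinimal] [NeZero (W.conductorNorm ℤ)]
    (hO6 : ClassO6 W 3) (hρ : ∀ n : ℕ, W.HasSurjectiveModNGaloisRep (3 ^ n : ℕ)) (hr : W.analyticRank = 1)
    (K : Type) [Field K] [NumberField K]
    (Dt : ModularParametrizationData W (W.conductorNorm ℤ))
    (H : HeegnerDatum (W.conductorNorm ℤ) (NumberField.discr K)) (ι : K →+* ℂ)
    (P : (W.baseChange K).toAffine.Point)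
    (hK : IsImaginaryQuadratic K) (hodd : Odd (NumberField.discr K))
    (hHH : SatisfiesHeegnerHypothesis (W.conductorNorm ℤ) K)
    (hLd : (W.quadraticTwist (NumberField.discr K : ℚ)).entireLFunction 1 ≠ 0)
    (hP : WeierstrassCurve.Affine.Point.map ι.toRatAlgHom P = heegnerPointComplex Dt H)
    (hI : padicValNat 3 (AddSubgroup.zmultiples P).index =
      padicValNat 3 W.tamagawaProduct + padicValNat 3 Dt.c.natAbs)
    (hglob : ∀ (s' : ℕ), s' ≤ padicValNat 3 W.tamagawaProduct + padicValNat 3 Dt.c.natAbs →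
      ∀ (n : ℕ) (d : KolyvaginHeegnerData Dt H.β ι n), Squarefree n →
        (∀ ℓ ∈ n.primeFactors, Zhang2014.IsKolyvaginPrime (W.conductorNorm ℤ) W K 3 ℓ ∧
          s' ≤ Zhang2014.kolyvaginIndex W 3 ℓ) → Koly.PDiv d 3 s') :
    BSDp W 3 := by
  have hsurj : W.HasSurjectiveModNGaloisRep 3 := by simpa using hρ 1
  -- `3 ∣ N_E` splits in `K`: `d_K ≠ -3`; `d_K` odd: `d_K ≠ -4`
  have h3N : 3 ∣ W.conductorNorm ℤ :=
    (W.dvd_conductorNorm_iff_not_hasGoodReductionAtPrime 3).mpr (not_good_of_addv W 3 hO6.2.1)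
  have h3 : NumberField.discr K ≠ -3 := by
    intro h
    exact (X11b.Three.not_dvd_discr_and_not_dvd_torsionOrder_of_heegner hK hHH (by decide) h3N).1
      (h ▸ ⟨-1, by norm_num⟩)
  have h4 : NumberField.discr K ≠ -4 := by
    intro h
    rw [h] at hodd
    exact (Int.not_odd_iff_even.mpr ⟨-2, by norm_num⟩) hodd
  -- the Heegner point is non-torsion (Gross–Zagier)
  have hL0 : W.entireLFunction 1 = 0 := entireLFunction_one_eq_zero_of_analyticRank_eq_one hr
  obtain ⟨-, hderiv⟩ := leadingLCoeff_eq_deriv_of_analyticRank_eq_one hr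
  have hLK : LDerivEK W K ≠ 0 := by
    rw [lDerivEK_eq_deriv_mul W K hmod hL0]; exact mul_ne_zero hderiv hLd
  have hnt : ¬ IsOfFinAddOrder P :=
    (lDerivEK_ne_zero_iff_not_isOfFinAddOrder W (W.conductorNorm ℤ) K (hGZ _ W K) hK hHH
      ⟨Dt, H, ι, hP⟩).mp hLK
  -- the upper socket at slack `v₃(c)` from global divisibility (§2), then both sockets (§1)
  have hup : Upper.IndexUpperBoundLeAt W 3 K P (padicValNat 3 Dt.c.natAbs) :=
    upper_of_globalDivisibility hKo hMcU W 3 (by decide) hρ K hK h3 h4 hHH Dt H ι P hP hnt hglob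
  obtain ⟨-, hlo, -⟩ := indexBounds_of_upper_of_index_le hup hI.le
  -- a globally minimal model of the twist, then kmc g17's descent with the rank-zero wild leaf
  have hD0 : (NumberField.discr K : ℚ) ≠ 0 := by exact_mod_cast NumberField.discr_ne_zero K
  haveI : (W.quadraticTwist (NumberField.discr K : ℚ)).IsElliptic := W.isElliptic_quadraticTwist hD0
  obtain ⟨Cd, hCd⟩ := hasGlobalMinimalModel_rat_holds (W.quadraticTwist (NumberField.discr K : ℚ))
  haveI : (Cd • W.quadraticTwist (NumberField.discr K : ℚ)).IsGloballyMinimal := hCd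
  exact bsdp_three_of_exactIndexManin_of_wAllExclAddWildRankZero hGZ hKo hGZK hmod hGZ73 hRZ W hO6 hsurj hr
    (W.conductorNorm ℤ) K Dt H ι P (Cd • W.quadraticTwist (NumberField.discr K : ℚ)) rfl hK hodd hHH hLd hP
    ⟨Cd, rfl⟩ hlo hup

end Summit.BirchSwinnertonDyer.BirchSwinnertonDyer.Theorems.SchneiderFree.Exact

end
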